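import Literature.IUT.HodgeTheaters.InitialThetaDataTorsionMonodromyProofs
import Literature.IUT.HodgeTheaters.PuncturedEllipticCoveringsCusps
import HarnessLib

/-!
# [IUTchI] Def 3.1 (c)(d) / [EtTh] Def 2.1: the `l`-torsion monodromy on CUSPIDAL INERTIA — one cusp controls all
# (proof-only companion of `InitialThetaDataTorsionMonodromy`; supports GAP-LEDGER G-L5d5g6-1)

S. Mochizuki, *Inter-universal Teichmüller theory I*, kurims manuscript (May 2020), Def 3.1 (c)(d) p. 62; *The étale theta
function …* ([EtTh]) Def 2.1 p. 36 («the restricted map `D_x → Q` is trivial») [cite: Mochizuki2012, Def 3.1(c)(d) p.62]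
(D-0012 claim key; series DISPUTED — finite group theory over abc-iut-L5-t2's REAL `InitialThetaData`, abc-iut-L5-t8's datum
`TorsionMonodromy` and abc-iut-L5-t1's cusp action `CuspGalois`; nothing of the series is asserted; no side on [IUTchIII] Cor. 3.12).

WHAT.  The (rel)-type law `hI : ∀ k ∈ I_{ε′}, τ(embK k) = 0` of abc-iut-L5-d5's `PiAvatarLocalArrowLawL1OfTorsionMonodromy`
(p445209; GAP G-L5d5g6-1 asks for a v-next field `tau_inertia : ∀ x, ∀ k ∈ I_x, τ(embK k) = 0` on `TorsionMonodromy`) is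
EQUIVALENT to its all-cusps form: `TorsionMonodromy.tau_inertia_all_of_one` / `tau_inertia_all_iff_one`.  Reason: the cusps of
`X̲_K` form ONE `Gal(X̲_K/X_K)`-orbit (`CuspGalois.transitive`), the chosen decomposition groups are permuted up to
`Π_X̲`-conjugacy (`CuspGalois.act_decomp`), inertia groups along with them (`Δ_{C_K}` is normal), and conjugation by an element of
`Π_{X_K} = embK(Π_X)` acts on `τ`-values through its Galois image (`tau_conj`), which FIXES `E_F[l]` (`G_K = Ker(G_F → GL₂(𝔽_l))`):
so all cuspidal inertia groups have the SAME `τ`-image.  Hence an NV witness / a v-next field at ONE cusp is one at every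
cusp, and the binder `hI` of the (L1) theorem is the whole printed «`D_x → Q` trivial» (E[l]-level, inertia form) and not
a choice of cusp.  Proof-only (0 definitions); axioms standard.  HONEST FRAMING: `M` is an interface datum, `CG` interface
data; typed ≠ inhabited ≠ discharged; nothing here bears on [IUTchIII] Cor. 3.12.
-/

noncomputable section

namespace Literature.IUT.HodgeTheaters

open scoped Pointwise

universe u v w

variable {F : Type u} {K : Type v} {Fbar : Type w} [Field F] [NumberField F] [Field K] [NumberField K]
  [Algebra F K] [Field Fbar] [Algebra F Fbar] [Algebra K Fbar]
  {E : WeierstrassCurve F} [E.IsElliptic] {l : ℕ} {Pb : BadPlacePredicates K}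

namespace InitialThetaData

variable {D : InitialThetaData F K Fbar E l Pb} (CG : D.geom.pe.CuspGalois)

/-- **Inertia groups are permuted by the cusp action, up to `Π_X̲`-conjugacy**: for `g ∈ Π_{C_K}` and a cusp `x` there is
`t ∈ Π_X̲` with `(t g)·I_x·(t g)⁻¹ = I_{g·x}` (`CuspGalois.act_decomp` intersected with the normal subgroup `Δ_{C_K}`).
([IUTchI] §1 p.37) [claim: Mochizuki2012, status: disputed] -/
theorem exists_conj_inertia_eq (g : D.geom.pe.PiC) (x : D.geom.pe.Cusp) :
    ∃ t ∈ D.geom.pe.PiXbar, MulAut.conj (t * g) • D.geom.pe.inertia x = D.geom.pe.inertia (CG.act g x) := by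
  obtain ⟨t, ht, h⟩ := CG.act_decomp g x
  refine ⟨t, ht, ?_⟩
  haveI : D.geom.pe.DeltaC.Normal := inferInstanceAs D.geom.pe.E.geom.Normal
  change MulAut.conj (t * g) • (D.geom.pe.decomp x ⊓ D.geom.pe.DeltaC) = D.geom.pe.decomp (CG.act g x) ⊓ D.geom.pe.DeltaC
  rw [Subgroup.smul_inf, h, Subgroup.Normal.conj_smul_eq_self]

namespace TorsionMonodromy

variable (M : D.TorsionMonodromy)

include M CG in
/-- **ONE CUSP CONTROLS ALL**: if `τ` vanishes on `embK(I_{x₀})` for one cusp `x₀`, it vanishes on `embK(I_x)` for every cusp `x`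
(the cusps are one `Gal(X̲_K/X_K)`-orbit; conjugation by `embK(Π_X) = Π_{X_K}` fixes `τ`-values, `tau_conj` with `G_K` acting
trivially on `E_F[l]`). ([IUTchI] Def 3.1(c)(d) p.62) [claim: Mochizuki2012, status: disputed] -/
theorem tau_inertia_all_of_one (x₀ : D.geom.pe.Cusp) (h₀ : ∀ k ∈ D.geom.pe.inertia x₀, M.tau (D.geom.embK k) = 0)
    (x : D.geom.pe.Cusp) : ∀ k ∈ D.geom.pe.inertia x, M.tau (D.geom.embK k) = 0 := by
  obtain ⟨g, hgX, hgx⟩ := CG.transitive x₀ x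
  obtain ⟨t, ht, hconj⟩ := exists_conj_inertia_eq CG g x₀
  rw [hgx] at hconj
  intro k hk
  rw [← hconj, Subgroup.mem_pointwise_smul_iff_inv_smul_mem] at hk
  -- `k₀ := (t g)⁻¹ k (t g) ∈ I_{x₀}`, `k = (t g) k₀ (t g)⁻¹`
  set k₀ : D.geom.pe.PiC := (MulAut.conj (t * g))⁻¹ • k with hk₀
  have hk₀I : k₀ ∈ D.geom.pe.inertia x₀ := hk
  have hkeq : k = (t * g) * k₀ * (t * g)⁻¹ := by
    rw [hk₀, MulAut.smul_def, MulAut.conj_inv_apply]; group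
  -- conjugator in `Π_{X_K} ≤ Π_{X_F}`, `k₀` in `Π_{X̲_K} ≤ Π_{X_K}`
  have htgX : t * g ∈ D.geom.pe.PiX := mul_mem ht.1 hgX
  have hcX : D.geom.embK (t * g) ∈ D.geom.PiX := by
    have : D.geom.embK (t * g) ∈ D.geom.pe.PiX.map D.geom.embK := ⟨t * g, htgX, rfl⟩
    rw [D.geom.embK_PiX] at this
    exact this.1
  have hk₀U : D.geom.embK k₀ ∈ D.PiXund := ⟨k₀, D.geom.pe.decomp_le x₀ hk₀I.1, rfl⟩
  have hk₀K : D.geom.embK k₀ ∈ D.PiXK := D.PiXund_le_PiXK hk₀U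
  rw [hkeq, map_mul, map_mul, map_inv, M.tau_conj hcX hk₀K, h₀ k₀ hk₀I, map_zero]

include M CG in
/-- **The all-cusps form of the law `hI` is equivalent to its one-cusp form at `ε′`** — the v-next field `tau_inertia` wanted by
GAP-LEDGER G-L5d5g6-1 and the binder `hI` of `localArrowLaw_L1_of_torsionMonodromy` (p445209) say the same thing.
([IUTchI] Def 3.1(c)(d) p.62) [claim: Mochizuki2012, status: disputed] -/
theorem tau_inertia_all_iff_one :
    (∀ x : D.geom.pe.Cusp, ∀ k ∈ D.geom.pe.inertia x, M.tau (D.geom.embK k) = 0) ↔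
      (∀ k ∈ D.geom.pe.inertia D.geom.pe.ε1, M.tau (D.geom.embK k) = 0) :=
  ⟨fun h => h D.geom.pe.ε1, fun h => M.tau_inertia_all_of_one CG D.geom.pe.ε1 h⟩

include M CG in
/-- The same equivalence based at the zero cusp `ε⁰` (the cusp over the origin of `E_F` — the natural place to state «`[l]` is
étale over `O`»). ([IUTchI] Def 3.1(c)(d) p.62) [claim: Mochizuki2012, status: disputed] -/
theorem tau_inertia_ε1_of_ε0 (h : ∀ k ∈ D.geom.pe.inertia D.geom.pe.ε0, M.tau (D.geom.embK k) = 0) :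
    ∀ k ∈ D.geom.pe.inertia D.geom.pe.ε1, M.tau (D.geom.embK k) = 0 :=
  M.tau_inertia_all_of_one CG D.geom.pe.ε0 h D.geom.pe.ε1

end TorsionMonodromy

end InitialThetaData

end Literature.IUT.HodgeTheaters

end
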